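import Literature.AnabelianGeometry.EtaleTheta.Discharge.Sec4Prop42SubZetaA
import Literature.AnabelianGeometry.EtaleTheta.Discharge.Sec4Prop42SubIvHolds
import Literature.AnabelianGeometry.EtaleTheta.Discharge.Sec4Prop42SubUnitRootsAt
import HarnessLib

/-!
# [EtTh] Prop. 4.2 (iv) ACROSS AN ISOMORPHISM OF FRACTION-PAIRS: the sub-nodes L06 `ZetaA`, L07 `ZetaB`,
# L07′ `RootUnitTorsion`, L08 `BetaCompat` ported from "two roots of the same pair" to "two roots of two
# isomorphic pairs", for an arbitrary domain `A`

Mochizuki, *The étale theta function and its Frobenioid-theoretic manifestations*, Publ. RIMS **45** (2009)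
[EtTh], §4, Proposition 4.2 (iv), statement PDF p.89 L1–12, proof p.90 L12–24 [cite: MochizukiEtTh2009, Prop 4.2 p.89];
the setting of §4, PDF p.86.

PROOF-ONLY companion (abc-iut cell, layer L2, node `EtTh:Thm5.7` / sub-DAG `plan/L2/SUBDAG-EtTh-Prop42.md` rows
L05–L08; row R480 «PROP42-IV-ISO» of abc-iut-L2-lead, re-armed to seat abc-iut-f-123 (gen 6) after abc-iut-L2-t4).
CONSUMER: the binder `hivPiso` of abc-iut-w6-d077's `…_final_v3` (`Discharge/Sec5Thm57FinalKnitV3.lean`) and of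
`…_final_v3_of_constantRootsLaw` (`Discharge/Sec5Thm57FinalKnitV3OfConstantRoots.lean`): «Prop. 4.2 (iv) at the
`u₁`-twisted level-1 pair, per normalised anchor, ACROSS an isomorphism of pairs» — the (r4) repair of the
unmeetable `hArises` (an `N`-th root cannot be transported along an isomorphism of its pair inside `BiKummerSetting`,
whose Def. 4.1 (iv)(e) predicate `ArisesFromBaseFrobeniusPair` carries no law; so Prop. 4.2 (iv) itself is stated
and proved across the isomorphism).  Nothing landed is edited or restated; no `def`, no instance, no new named fact.

THE SHAPE.  `R` is an `N`-th root of a fraction-pair `P = (s', s'') : A → B` for `f ∈ O^×(A^birat)` (ARBITRARY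
domain `A`, not only `A_⊙`), `R₂` an `N`-th root of a fraction-pair `P₂ : A₂ → B₂` for `f₂`, and `eA : A₂ ⥲ A`,
`eB : B₂ ⥲ B` identify the pairs: `eA⁻¹ ≫ s'₂ ≫ eB = s'`, `eA⁻¹ ≫ s''₂ ≫ eB = s''`.  Given a base isomorphism
`Ā' : A_N^bs ⥲ Ā_N^bs` with `Base(α) = Ā' ≫ Base(ᾱ ≫ eA)`, there are `v ∈ μ_N(B_N)`, `ζ_A : A_N ⥲ Ā_N`,
`ζ_B : B_N ⥲ B̄_N` with `ζ_A ≫ s̄'_N = s'_N ≫ ζ_B`, `ζ_A ≫ s̄''_N = s''_N ≫ v ≫ ζ_B`, `ζ_A ≫ ᾱ ≫ eA = α`,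
`ζ_B ≫ β̄ ≫ eB = β`, `Base(ζ_A) = Ā'` (`prop42_iv_iso_of_unitRootsUpstairsAt`; at `eA = eB = id`, `A = A_⊙` this is
the typed node `BiKummerSetting.Prop42_iv`).  (The clause «`((eA)^birat)^* f = f₂`» is not needed.)

THE PROOFS are those of record with `eA`, `eB` inserted:
* L08 `betaCompat_iso`, L07′ `rootUnitTorsion_iso` — abc-iut-f-131's law-free cancellation
  (`TemperedFrobenioid.eq_of_comp_eq_of_isUnit_div`, `pow_eq_one_of_mem_units`; `Sec4Prop42SubIvHolds.lean`), using
  `s'₂ ≫ eB = eA ≫ s'`;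
* L07 `zetaB_upto_unit_iso` (modulo «`Φ` divisorial», [FrdI] Thm. 5.2 (ii)) — abc-iut-w5-d134's `zetaB_upto_unit_of`:
  `Div(ζ_A) = 0` from `ζ_A ≫ ᾱ ≫ eA = α` (isometries of degree `N`, torsion-freeness), `Div(s'₂) = Base(eA)^* Div(s')`
  (`ModelFrobenioid.div_comp_of_isIso`/`'`), `N · Div(s'_N) = α^* Div(s')` (`NthRoot.div_num_pow`), then [FrdI] Thm. 5.2 (ii)
  `exists_iso_comp_eq_of_div_eq`;
* L06 `zetaA_iso_of_unitRootsUpstairsAt` (modulo «`Φ` divisorial», the canonical reading `hE` of Def. 4.1 (iv)(e), and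
  L05 AT THE ROOT `R` — abc-iut-w4-d044's binder shape `unitRootsUpstairsAt`, p457540) — abc-iut-w4-d044's
  `zetaA_of_unitRootsUpstairs` (p.90 L17–21: naturality of the Frobenius sections along `α'`, [FrdI] Def. 1.3 (ii), the
  pull-back property of `α', ᾱ'`, L05, Frobenius-normalization) with the Frobenius endomorphism `F̄(n̄)_{A₂}` CONJUGATED BY
  `eA` before comparing it with `F(n)_A`, and the lift `ζ₀` of `Ā'` through `ᾱ'` taken at the datum `(α' ≫ eA⁻¹, Ā')`.
COROLLARY `prop42_iv_iso_of_constantRootsAt`: the same with L05 fed by the roots-of-constants law over the domain `A`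
(abc-iut-w4-d044's `unitRootsUpstairsAt_of_constantRootsAt`).
HONEST FRAMING: refereed pre-IUT material ([EtTh] 2009, [FrdI] 2008); typed ≠ proved for the inputs `hE` / L05 / the law;
nothing here bears on, or takes a side on, the disputed [IUTchIII] Cor. 3.12.
-/

namespace Literature.AnabelianGeometry.EtaleTheta

open CategoryTheory Opposite Literature.AlgebraicGeometry.Frobenioids

universe u₀ v₀ u v w

variable {K : Type u₀} [Field K]

namespace BiKummerSetting

variable {X : SemiGraphs.TemperedArithmeticGroup.{u₀} K} {D₀ : Type u₀} [Category.{v₀} D₀]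
  {V : FrdIMonoidStub.{w}} {T : RealifiedDivisorMonoids (D₀ := D₀) V} {D : Type u} [Category.{v} D]
  {VD : FrdICatStub.{u, v, w} D} (S : BiKummerSetting X T D VD)

namespace Prop42Sub

variable (pullFrac : ∀ {A A' : S.C} (_ : A' ⟶ A), S.biratUnits A → S.biratUnits A')

/-! ## §1. L08 and L07′ across the isomorphism (law-free) -/

/-- **(iv)/L08 `BetaCompat` across an isomorphism of pairs** (statement p.89 L8 «`β = β̄ ∘ ζ_B`»): for roots `R` of
`P : A → B` and `R₂` of `P₂ : A₂ → B₂` with `eA⁻¹ ≫ s'₂ ≫ eB = s'`, an isomorphism `ζ_A` over `α, ᾱ ≫ eA` and `ζ_B`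
completing the `s'_N`-square: `ζ_B ≫ β̄ ≫ eB = β` — both complete the `s'_N`-square under `s' ∘ α`, and the pre-step
`s'_N` cancels (law-free total epimorphicity, abc-iut-f-131). [cite: MochizukiEtTh2009, Prop 4.2 p.89] -/
theorem betaCompat_iso {A B : S.C} {f : S.biratUnits A} {P : S.FractionPair f B} {N : ℕ+}
    (R : S.NthRoot f P N pullFrac) {A₂ B₂ : S.C} {f₂ : S.biratUnits A₂} {P₂ : S.FractionPair f₂ B₂}
    (R₂ : S.NthRoot f₂ P₂ N pullFrac) (eA : A₂ ≅ A) (eB : B₂ ≅ B) (hn : eA.inv ≫ P₂.num ≫ eB.hom = P.num)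
    (ζA : R.AN ≅ R₂.AN) (ζB : R.BN ≅ R₂.BN) (hα : ζA.hom ≫ R₂.α ≫ eA.hom = R.α)
    (hnum : ζA.hom ≫ R₂.pair.num = R.pair.num ≫ ζB.hom) : ζB.hom ≫ R₂.β ≫ eB.hom = R.β := by
  haveI : IsIso (ModelFrobenioid.baseMap R.pair.num) := R.pair.isPreStep_num.2
  have hn' : P₂.num ≫ eB.hom = eA.hom ≫ P.num := by rw [← hn, Iso.hom_inv_id_assoc]
  have e : R.pair.num ≫ ζB.hom ≫ R₂.β ≫ eB.hom = R.pair.num ≫ R.β :=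
    calc R.pair.num ≫ ζB.hom ≫ R₂.β ≫ eB.hom = (ζA.hom ≫ R₂.pair.num) ≫ R₂.β ≫ eB.hom := by
          rw [hnum, Category.assoc]
      _ = ζA.hom ≫ (R₂.pair.num ≫ R₂.β) ≫ eB.hom := by simp only [Category.assoc]
      _ = ζA.hom ≫ R₂.α ≫ P₂.num ≫ eB.hom := by rw [R₂.comm_num, Category.assoc]
      _ = ζA.hom ≫ R₂.α ≫ eA.hom ≫ P.num := by rw [hn']
      _ = R.α ≫ P.num := by rw [← hα]; simp only [Category.assoc]
      _ = R.pair.num ≫ R.β := R.comm_num.symm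
  have hβ : ModelFrobenioid.div R.β = 1 := R.isIsometry.2.1
  have hβ₂ : ModelFrobenioid.div R₂.β = 1 := R₂.isIsometry.2.1
  refine S.tf.eq_of_comp_eq_of_isUnit_div R.pair.num e ?_ (by rw [hβ]; exact isUnit_one)
  rw [ModelFrobenioid.div_comp_pull]
  refine IsUnit.mul (IsUnit.map _ ?_) ((PreFrobenioid.isUnit_div_of_isIso S.F ζB.hom).pow _)
  rw [ModelFrobenioid.div_comp_pull, hβ₂, one_pow, mul_one]
  exact (PreFrobenioid.isUnit_div_of_isIso S.F eB.hom).map _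

/-- **(iv)/L07′ `RootUnitTorsion` across an isomorphism of pairs** («for some `u ∈ μ_N(B_N)`», p.89 L4): with also
`eA⁻¹ ≫ s''₂ ≫ eB = s''`, the unit `u ∈ O^×(B_N)` relating the two denominator squares is `N`-torsion — from L08 and the
denominator squares `s''_N ≫ u ≫ β = s''_N ≫ β`, the pre-step `s''_N` cancels (law-free), so `u ≫ β = β` with `β` an
isometry of Frobenius degree `N`, whence `Div(u)^N = 1`, `u_u^N = 1`, `u^N = 1` (abc-iut-f-131's argument).
[cite: MochizukiEtTh2009, Prop 4.2 p.89] -/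
theorem rootUnitTorsion_iso {A B : S.C} {f : S.biratUnits A} {P : S.FractionPair f B} {N : ℕ+}
    (R : S.NthRoot f P N pullFrac) {A₂ B₂ : S.C} {f₂ : S.biratUnits A₂} {P₂ : S.FractionPair f₂ B₂}
    (R₂ : S.NthRoot f₂ P₂ N pullFrac) (eA : A₂ ≅ A) (eB : B₂ ≅ B) (hn : eA.inv ≫ P₂.num ≫ eB.hom = P.num)
    (hd : eA.inv ≫ P₂.den ≫ eB.hom = P.den) (ζA : R.AN ≅ R₂.AN) (ζB : R.BN ≅ R₂.BN) (u : Aut R.BN)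
    (hu : u ∈ S.units R.BN) (hα : ζA.hom ≫ R₂.α ≫ eA.hom = R.α)
    (hnum : ζA.hom ≫ R₂.pair.num = R.pair.num ≫ ζB.hom)
    (hden : ζA.hom ≫ R₂.pair.den = (R.pair.den ≫ u.hom) ≫ ζB.hom) : u ^ (N : ℕ) = 1 := by
  have hu' : u ∈ ModelFrobenioid.units R.BN := ⟨hu.1, hu.2⟩
  haveI : IsIso (ModelFrobenioid.baseMap R.pair.den) := R.pair.isPreStep_den.2
  have hd' : P₂.den ≫ eB.hom = eA.hom ≫ P.den := by rw [← hd, Iso.hom_inv_id_assoc]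
  -- L08: `ζ_B ≫ β̄ ≫ eB = β`
  have hβc : ζB.hom ≫ R₂.β ≫ eB.hom = R.β := betaCompat_iso S pullFrac R R₂ eA eB hn ζA ζB hα hnum
  -- the denominator squares: `s''_N ≫ (u ≫ β) = s''_N ≫ β`
  have e : R.pair.den ≫ u.hom ≫ R.β = R.pair.den ≫ R.β :=
    calc R.pair.den ≫ u.hom ≫ R.β = R.pair.den ≫ u.hom ≫ ζB.hom ≫ R₂.β ≫ eB.hom := by rw [hβc]
      _ = ((R.pair.den ≫ u.hom) ≫ ζB.hom) ≫ R₂.β ≫ eB.hom := by simp only [Category.assoc]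
      _ = (ζA.hom ≫ R₂.pair.den) ≫ R₂.β ≫ eB.hom := by rw [← hden]
      _ = ζA.hom ≫ (R₂.pair.den ≫ R₂.β) ≫ eB.hom := by simp only [Category.assoc]
      _ = ζA.hom ≫ R₂.α ≫ P₂.den ≫ eB.hom := by rw [R₂.comm_den, Category.assoc]
      _ = ζA.hom ≫ R₂.α ≫ eA.hom ≫ P.den := by rw [hd']
      _ = R.α ≫ P.den := by rw [← hα]; simp only [Category.assoc]
      _ = R.pair.den ≫ R.β := R.comm_den.symm
  have hβ : ModelFrobenioid.div R.β = 1 := R.isIsometry.2.1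
  have hN : ModelFrobenioid.degFr R.β = N := R.isIsometry.2.2.2
  have hdu : IsUnit (ModelFrobenioid.div u.hom) := PreFrobenioid.isUnit_div_of_isIso S.F u.hom
  have huβ : u.hom ≫ R.β = R.β := by
    refine S.tf.eq_of_comp_eq_of_isUnit_div R.pair.den e ?_ (by rw [hβ]; exact isUnit_one)
    rw [ModelFrobenioid.div_comp_pull, hβ, map_one, one_mul]
    exact hdu.pow _
  haveI : IsCancelMul (S.tf.ratFnFunctor.obj (op R.BN.base)) :=
    isIntegral_iff_isCancelMul.mp
      (S.tf.isGroupLike_ratFnFunctor T.isUnit_BΛ R.BN.base).isPreDivisorial.isIntegral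
  have hunit : ModelFrobenioid.unit u.hom ^ (N : ℕ) = 1 := by
    have h := congrArg ModelFrobenioid.unit huβ
    rw [ModelFrobenioid.unit_comp, hu'.1, ModelFrobenioid.map_id_apply_B, hN] at h
    exact mul_left_cancel (h.trans (mul_one _).symm)
  have hdiv : ModelFrobenioid.div u.hom ^ (N : ℕ) = 1 := by
    have h := congrArg ModelFrobenioid.div huβ
    rw [ModelFrobenioid.div_comp, hu'.1, ModelFrobenioid.map_id_apply_Φ, hN, hβ, one_mul] at h
    exact h
  exact S.tf.pow_eq_one_of_mem_units hu' hdiv hunit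

/-! ## §2. L07 across the isomorphism, up to its `μ_N`-clause (modulo «`Φ` divisorial») -/

/-- `Div(ζ_A) = 0` for an isomorphism `ζ_A : A_N ⥲ Ā_N` with `ζ_A ≫ ᾱ ≫ eA = α`: `α`, `ᾱ ≫ eA` are isometries of
Frobenius degree `N`, so `N · Div(ζ_A) = 0`, and `Φ(A_N)` is torsion-free (`Φ` divisorial).
[cite: MochizukiEtTh2009, Prop 4.2 p.90] -/
theorem div_zetaA_iso_eq_one (hΦd : Objectwise (fun M _ => IsDivisorial M) S.tf.divisorMonoid)
    {A B : S.C} {f : S.biratUnits A} {P : S.FractionPair f B} {N : ℕ+}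
    (R : S.NthRoot f P N pullFrac) {A₂ B₂ : S.C} {f₂ : S.biratUnits A₂} {P₂ : S.FractionPair f₂ B₂}
    (R₂ : S.NthRoot f₂ P₂ N pullFrac) (eA : A₂ ≅ A) (ζA : R.AN ≅ R₂.AN) (hζ : ζA.hom ≫ R₂.α ≫ eA.hom = R.α) :
    ModelFrobenioid.div ζA.hom = 1 := by
  have hα : ModelFrobenioid.div R.α = 1 := R.isIsometry.1
  have hα₂ : ModelFrobenioid.div R₂.α = 1 := R₂.isIsometry.1
  have hN₂ : ModelFrobenioid.degFr R₂.α = N := R₂.isIsometry.2.2.1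
  have hαe : ModelFrobenioid.div (R₂.α ≫ eA.hom) = 1 := by
    rw [ModelFrobenioid.div_comp_of_isIso hΦd R₂.α eA.hom, hα₂]
  have hNe : ModelFrobenioid.degFr (R₂.α ≫ eA.hom) = N := by
    rw [ModelFrobenioid.degFr_comp, ModelFrobenioid.degFr_eq_one_of_isIso eA.hom, one_mul, hN₂]
  have e := congrArg ModelFrobenioid.div hζ
  rw [ModelFrobenioid.div_comp_pull, hαe, map_one, one_mul, hNe, hα] at e
  exact pow_injective_of_isDivisorial (hΦd R.AN.base) N (e.trans (one_pow _).symm)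

/-- The base of `ζ_A ≫ ᾱ ≫ eA = α`: `Base(ζ_A) ≫ Base(ᾱ) ≫ Base(eA) = Base(α)`. [cite: MochizukiEtTh2009, Prop 4.2 p.90] -/
theorem baseMap_zetaA_iso {A B : S.C} {f : S.biratUnits A} {P : S.FractionPair f B} {N : ℕ+}
    (R : S.NthRoot f P N pullFrac) {A₂ B₂ : S.C} {f₂ : S.biratUnits A₂} {P₂ : S.FractionPair f₂ B₂}
    (R₂ : S.NthRoot f₂ P₂ N pullFrac) (eA : A₂ ≅ A) (ζA : R.AN ≅ R₂.AN) (hζ : ζA.hom ≫ R₂.α ≫ eA.hom = R.α) :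
    ModelFrobenioid.baseMap ζA.hom ≫ ModelFrobenioid.baseMap R₂.α ≫ ModelFrobenioid.baseMap eA.hom =
      ModelFrobenioid.baseMap R.α := by
  rw [← ModelFrobenioid.baseMap_comp, ← ModelFrobenioid.baseMap_comp, hζ]

/-- `s'₂ = eA ≫ s' ≫ eB⁻¹` from `eA⁻¹ ≫ s'₂ ≫ eB = s'`. [cite: MochizukiEtTh2009, Prop 4.2 p.89] -/
theorem eq_hom_comp_comp_inv_of {A B A₂ B₂ : S.C} (eA : A₂ ≅ A) (eB : B₂ ≅ B) {s₂ : A₂ ⟶ B₂} {s : A ⟶ B}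
    (h : eA.inv ≫ s₂ ≫ eB.hom = s) : s₂ = eA.hom ≫ s ≫ eB.inv := by
  rw [← h]
  simp only [Category.assoc, Iso.hom_inv_id_assoc, Iso.hom_inv_id, Category.comp_id]

/-- `Div(s'₂) = Base(eA)^* Div(s')` for `s'₂ = eA ≫ s' ≫ eB⁻¹` (`Φ` divisorial: isomorphisms have `Div = 0`).
[cite: MochizukiFrdI2008, Thm. 5.2(ii) p.101] -/
theorem div_eq_pull_of_iso_conj (hΦd : Objectwise (fun M _ => IsDivisorial M) S.tf.divisorMonoid)
    {A B A₂ B₂ : S.C} (eA : A₂ ≅ A) (eB : B₂ ≅ B) {s₂ : A₂ ⟶ B₂} {s : A ⟶ B}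
    (h : eA.inv ≫ s₂ ≫ eB.hom = s) :
    ModelFrobenioid.div s₂ = pull S.tf.divisorMonoid (ModelFrobenioid.baseMap eA.hom) (ModelFrobenioid.div s) := by
  rw [eq_hom_comp_comp_inv_of S eA eB h, ModelFrobenioid.div_comp_of_isIso' hΦd eA.hom,
    ModelFrobenioid.div_comp_of_isIso hΦd s eB.inv]

/-- **(iv)/L07, numerator half, across an isomorphism of pairs** (modulo «`Φ` divisorial»): given `ζ_A` over
`α, ᾱ ≫ eA`, the isomorphism `ζ_B : B_N ⥲ B̄_N` with `ζ_A ≫ s̄'_N = s'_N ≫ ζ_B` EXISTS — `N · Div(s'_N) = α^* Div(s') =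
ζ_A^* ᾱ^* eA^* Div(s') = ζ_A^* ᾱ^* Div(s'₂) = N · ζ_A^* Div(s̄'_N)`, `Φ(A_N)` torsion-free, `Div(ζ_A) = 0`, so the two
pre-steps `s'_N`, `ζ_A ≫ s̄'_N` out of `A_N` have the same divisor ([FrdI] Thm. 5.2 (ii), Def. 1.3 (iii)(d)).
[cite: MochizukiEtTh2009, Prop 4.2 p.90] -/
theorem exists_zetaB_num_iso (hΦd : Objectwise (fun M _ => IsDivisorial M) S.tf.divisorMonoid)
    {A B : S.C} {f : S.biratUnits A} {P : S.FractionPair f B} {N : ℕ+}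
    (R : S.NthRoot f P N pullFrac) {A₂ B₂ : S.C} {f₂ : S.biratUnits A₂} {P₂ : S.FractionPair f₂ B₂}
    (R₂ : S.NthRoot f₂ P₂ N pullFrac) (eA : A₂ ≅ A) (eB : B₂ ≅ B) (hn : eA.inv ≫ P₂.num ≫ eB.hom = P.num)
    (ζA : R.AN ≅ R₂.AN) (hζ : ζA.hom ≫ R₂.α ≫ eA.hom = R.α) :
    ∃ ζB : R.BN ≅ R₂.BN, ζA.hom ≫ R₂.pair.num = R.pair.num ≫ ζB.hom := by
  haveI : IsIso (ModelFrobenioid.baseMap R.pair.num) := R.pair.isPreStep_num.2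
  haveI : IsIso (ModelFrobenioid.baseMap R₂.pair.num) := R₂.pair.isPreStep_num.2
  haveI : IsIso (ModelFrobenioid.baseMap (ζA.hom ≫ R₂.pair.num)) := by
    rw [ModelFrobenioid.baseMap_comp]
    haveI : IsIso (ModelFrobenioid.baseMap ζA.hom) := ModelFrobenioid.isIso_baseMap_of_isIso ζA.hom
    infer_instance
  have h1 : ModelFrobenioid.degFr R.pair.num = 1 := R.pair.isPreStep_num.1
  have h1₂ : ModelFrobenioid.degFr R₂.pair.num = 1 := R₂.pair.isPreStep_num.1
  have hdeg : ModelFrobenioid.degFr R.pair.num = ModelFrobenioid.degFr (ζA.hom ≫ R₂.pair.num) := by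
    rw [ModelFrobenioid.degFr_comp, ModelFrobenioid.degFr_eq_one_of_isIso ζA.hom, mul_one, h1, h1₂]
  have hP₂ := div_eq_pull_of_iso_conj S hΦd eA eB hn
  have hb := baseMap_zetaA_iso S pullFrac R R₂ eA ζA hζ
  have hdiv : ModelFrobenioid.div R.pair.num = ModelFrobenioid.div (ζA.hom ≫ R₂.pair.num) := by
    apply pow_injective_of_isDivisorial (hΦd R.AN.base) N
    rw [R.div_num_pow, ModelFrobenioid.div_comp_of_isIso' hΦd ζA.hom, ← map_pow, R₂.div_num_pow, hP₂,
      ← pull_comp, ← pull_comp, Category.assoc, hb]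
  obtain ⟨v, hv⟩ := ModelFrobenioid.exists_iso_comp_eq_of_div_eq
    (S.tf.isGroupLike_ratFnFunctor T.isUnit_BΛ) R.pair.num (ζA.hom ≫ R₂.pair.num) hdeg hdiv
  exact ⟨v, hv.symm⟩

/-- **(iv)/L07, denominator half, across an isomorphism of pairs** (modulo «`Φ` divisorial»): `ζ_B'' : B_N ⥲ B̄_N` with
`ζ_A ≫ s̄''_N = s''_N ≫ ζ_B''`. [cite: MochizukiEtTh2009, Prop 4.2 p.90] -/
theorem exists_zetaB_den_iso (hΦd : Objectwise (fun M _ => IsDivisorial M) S.tf.divisorMonoid)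
    {A B : S.C} {f : S.biratUnits A} {P : S.FractionPair f B} {N : ℕ+}
    (R : S.NthRoot f P N pullFrac) {A₂ B₂ : S.C} {f₂ : S.biratUnits A₂} {P₂ : S.FractionPair f₂ B₂}
    (R₂ : S.NthRoot f₂ P₂ N pullFrac) (eA : A₂ ≅ A) (eB : B₂ ≅ B) (hd : eA.inv ≫ P₂.den ≫ eB.hom = P.den)
    (ζA : R.AN ≅ R₂.AN) (hζ : ζA.hom ≫ R₂.α ≫ eA.hom = R.α) :
    ∃ ζB : R.BN ≅ R₂.BN, ζA.hom ≫ R₂.pair.den = R.pair.den ≫ ζB.hom := by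
  haveI : IsIso (ModelFrobenioid.baseMap R.pair.den) := R.pair.isPreStep_den.2
  haveI : IsIso (ModelFrobenioid.baseMap R₂.pair.den) := R₂.pair.isPreStep_den.2
  haveI : IsIso (ModelFrobenioid.baseMap (ζA.hom ≫ R₂.pair.den)) := by
    rw [ModelFrobenioid.baseMap_comp]
    haveI : IsIso (ModelFrobenioid.baseMap ζA.hom) := ModelFrobenioid.isIso_baseMap_of_isIso ζA.hom
    infer_instance
  have h1 : ModelFrobenioid.degFr R.pair.den = 1 := R.pair.isPreStep_den.1
  have h1₂ : ModelFrobenioid.degFr R₂.pair.den = 1 := R₂.pair.isPreStep_den.1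
  have hdeg : ModelFrobenioid.degFr R.pair.den = ModelFrobenioid.degFr (ζA.hom ≫ R₂.pair.den) := by
    rw [ModelFrobenioid.degFr_comp, ModelFrobenioid.degFr_eq_one_of_isIso ζA.hom, mul_one, h1, h1₂]
  have hP₂ := div_eq_pull_of_iso_conj S hΦd eA eB hd
  have hb := baseMap_zetaA_iso S pullFrac R R₂ eA ζA hζ
  have hdiv : ModelFrobenioid.div R.pair.den = ModelFrobenioid.div (ζA.hom ≫ R₂.pair.den) := by
    apply pow_injective_of_isDivisorial (hΦd R.AN.base) N
    rw [R.div_den_pow, ModelFrobenioid.div_comp_of_isIso' hΦd ζA.hom, ← map_pow, R₂.div_den_pow, hP₂,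
      ← pull_comp, ← pull_comp, Category.assoc, hb]
  obtain ⟨v, hv⟩ := ModelFrobenioid.exists_iso_comp_eq_of_div_eq
    (S.tf.isGroupLike_ratFnFunctor T.isUnit_BΛ) R.pair.den (ζA.hom ≫ R₂.pair.den) hdeg hdiv
  exact ⟨v, hv.symm⟩

/-- **(iv)/L07 up to its `μ_N`-clause, across an isomorphism of pairs** (modulo «`Φ` divisorial»): given `ζ_A` over
`α, ᾱ ≫ eA` there are `ζ_B : B_N ⥲ B̄_N` and a UNIT `u ∈ O^×(B_N)` with `ζ_A ≫ s̄'_N = s'_N ≫ ζ_B` and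
`ζ_A ≫ s̄''_N = s''_N ≫ u ≫ ζ_B` (`u := ζ_B'' ≫ ζ_B⁻¹`; same base because both pairs are base-equivalent).
[cite: MochizukiEtTh2009, Prop 4.2 p.90] -/
theorem zetaB_upto_unit_iso (hΦd : Objectwise (fun M _ => IsDivisorial M) S.tf.divisorMonoid)
    {A B : S.C} {f : S.biratUnits A} {P : S.FractionPair f B} {N : ℕ+}
    (R : S.NthRoot f P N pullFrac) {A₂ B₂ : S.C} {f₂ : S.biratUnits A₂} {P₂ : S.FractionPair f₂ B₂}
    (R₂ : S.NthRoot f₂ P₂ N pullFrac) (eA : A₂ ≅ A) (eB : B₂ ≅ B) (hn : eA.inv ≫ P₂.num ≫ eB.hom = P.num)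
    (hd : eA.inv ≫ P₂.den ≫ eB.hom = P.den) (ζA : R.AN ≅ R₂.AN) (hζ : ζA.hom ≫ R₂.α ≫ eA.hom = R.α) :
    ∃ (u : Aut R.BN) (ζB : R.BN ≅ R₂.BN), u ∈ S.units R.BN ∧
      ζA.hom ≫ R₂.pair.num = R.pair.num ≫ ζB.hom ∧
        ζA.hom ≫ R₂.pair.den = (R.pair.den ≫ u.hom) ≫ ζB.hom := by
  obtain ⟨ζB, hB⟩ := exists_zetaB_num_iso S pullFrac hΦd R R₂ eA eB hn ζA hζ
  obtain ⟨ζB'', hB''⟩ := exists_zetaB_den_iso S pullFrac hΦd R R₂ eA eB hd ζA hζ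
  haveI : IsIso (ModelFrobenioid.baseMap R.pair.num) := R.pair.isPreStep_num.2
  have hbase : ModelFrobenioid.baseMap ζB''.hom = ModelFrobenioid.baseMap ζB.hom := by
    have h1 := congrArg ModelFrobenioid.baseMap hB
    have h2 := congrArg ModelFrobenioid.baseMap hB''
    rw [ModelFrobenioid.baseMap_comp, ModelFrobenioid.baseMap_comp] at h1 h2
    have hRb : ModelFrobenioid.baseMap R.pair.den = ModelFrobenioid.baseMap R.pair.num := R.pair.base_eq.symm
    have hR'b : ModelFrobenioid.baseMap R₂.pair.den = ModelFrobenioid.baseMap R₂.pair.num :=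
      R₂.pair.base_eq.symm
    rw [hRb, hR'b] at h2
    exact (cancel_epi (ModelFrobenioid.baseMap R.pair.num)).mp (h2.symm.trans h1)
  refine ⟨ζB'' ≪≫ ζB.symm, ζB, ?_, hB, ?_⟩
  · have hu := ModelFrobenioid.trans_symm_mem_units ζB'' ζB hbase
    exact ⟨hu.1, hu.2⟩
  · rw [Iso.trans_hom, Iso.symm_hom, Category.assoc, Category.assoc, Iso.inv_hom_id, Category.comp_id]
    exact hB''

/-! ## §3. L06 across the isomorphism: `ζ_A` from L05 at the root `R` -/

/-- **(iv)/L06 `ZetaA` across an isomorphism of pairs, from L05 AT THE ROOT `R`** (modulo «`Φ` divisorial» and the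
canonical reading `hE` of Def. 4.1 (iv)(e) — a base-Frobenius pair `(P, F)` of `C`, [FrdI] Def. 2.7, with `α'`
`P`-distinguished and `α'' = F(n)_{A_N}`; definitionally so at the canonical model instances): for an `N`-th root `R` of a
pair with domain `A`, an `N`-th root `R₂` of a pair with domain `A₂`, `eA : A₂ ⥲ A`, and a base isomorphism
`Ā' : A_N^bs ⥲ Ā_N^bs` with `Base(α) = Ā' ≫ Base(ᾱ ≫ eA)`, there is `ζ_A : A_N ⥲ Ā_N` with `ζ_A ≫ ᾱ ≫ eA = α` and
`Base(ζ_A) = Ā'`.  PROOF (p.90 L14–21, abc-iut-w4-d044's `zetaA_of_unitRootsUpstairs` with `eA` inserted): with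
`α = α' ≫ F(n)_A`, `ᾱ = ᾱ' ≫ F̄(n̄)_{A₂}` (naturality of the Frobenius sections), the base-identity endomorphisms `F(n)_A`
and `eA⁻¹ ≫ F̄(n̄)_{A₂} ≫ eA` of `A` have the same Frobenius degree `N` and `Div = 0`, hence differ by a unit
`x ∈ O^×(A)` ([FrdI] Def. 1.3 (ii)); the pull-back property of `ᾱ'` lifts `Ā'` to `ζ₀ : A_N ⥲ Ā_N` with
`ζ₀ ≫ ᾱ' = α' ≫ eA⁻¹`; the pull-back property of `α'` lifts `x⁻¹` to a unit `y` of `A_N`, which L05 at `R` makes an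
`N`-th power `y = tᴺ`; Frobenius-normalization (`t ≫ α'' = α'' ≫ tᴺ`) then gives `ζ_A := t ≫ ζ₀`.
[cite: MochizukiEtTh2009, Prop 4.2 p.90] -/
theorem zetaA_iso_of_unitRootsUpstairsAt (hΦd : Objectwise (fun M _ => IsDivisorial M) S.tf.divisorMonoid)
    (hE : ∀ {A B : S.C} (G : Subgroup (Aut A)) (α₂ : A ⟶ A) (α₁ : A ⟶ B),
      S.ArisesFromBaseFrobeniusPair G α₂ α₁ → S.tf.ArisesFromBaseFrobeniusPair G α₂ α₁)
    {A B : S.C} {f : S.biratUnits A} {P : S.FractionPair f B} {N : ℕ+} (R : S.NthRoot f P N pullFrac)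
    (h₅ : ∀ (x : Aut A) (x' : Aut R.AN), x ∈ S.units A → x' ∈ S.units R.AN →
      x'.hom ≫ R.αData.α₁ = R.αData.α₁ ≫ x.hom → ∃ y ∈ S.units R.AN, y ^ (N : ℕ) = x')
    {A₂ B₂ : S.C} {f₂ : S.biratUnits A₂} {P₂ : S.FractionPair f₂ B₂} (R₂ : S.NthRoot f₂ P₂ N pullFrac)
    (eA : A₂ ≅ A) (ebs : S.base.obj R.AN ≅ S.base.obj R₂.AN)
    (hebs : S.base.map R.α = ebs.hom ≫ S.base.map (R₂.α ≫ eA.hom)) :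
    ∃ ζA : R.AN ≅ R₂.AN, ζA.hom ≫ R₂.α ≫ eA.hom = R.α ∧ S.base.mapIso ζA = ebs := by
  have hBg : Objectwise (fun M _ => IsGroupLike M) S.tf.ratFnFunctor := S.tf.isGroupLike_ratFnFunctor T.isUnit_BΛ
  -- the two base-Frobenius pairs (Def. 4.1 (iv)(e), canonical reading) and the Frobenius endomorphisms
  -- `φo = F(n)_A`, `φo' = F̄(n̄)_{A₂}`: `α = α' ≫ φo`, `ᾱ = ᾱ' ≫ φo'`
  obtain ⟨Pr, Fr, hPF, -, hα₁, hα₂⟩ := hE _ _ _ R.αData.cond_e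
  obtain ⟨Pr', Fr', hPF', -, hα₁', hα₂'⟩ := hE _ _ _ R₂.αData.cond_e
  obtain ⟨φo, hnat, hbo, hdo⟩ := exists_comp_frobenius_of_distinguished S hPF hα₁ hα₂
  obtain ⟨φo', hnat', hbo', hdo'⟩ := exists_comp_frobenius_of_distinguished S hPF' hα₁' hα₂'
  rw [R.αData.fac] at hnat
  rw [R₂.αData.fac] at hnat'
  have hp₁ := ModelFrobenioid.degFr_div_of_isPullbackMorphism hΦd R.αData.cond_d
  have hp₁' := ModelFrobenioid.degFr_div_of_isPullbackMorphism hΦd R₂.αData.cond_d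
  have hN : ModelFrobenioid.degFr R.α = N := R.isIsometry.2.2.1
  have hN' : ModelFrobenioid.degFr R₂.α = N := R₂.isIsometry.2.2.1
  have hdego : ModelFrobenioid.degFr φo = N := by
    have h := congrArg ModelFrobenioid.degFr hnat
    rw [ModelFrobenioid.degFr_comp, hp₁.1, mul_one, hN] at h
    exact h
  have hdego' : ModelFrobenioid.degFr φo' = N := by
    have h := congrArg ModelFrobenioid.degFr hnat'
    rw [ModelFrobenioid.degFr_comp, hp₁'.1, mul_one, hN'] at h
    exact h
  -- `Base(eA⁻¹) ≫ Base(eA) = id`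
  have heA₂ : ModelFrobenioid.baseMap eA.inv ≫ ModelFrobenioid.baseMap eA.hom = 𝟙 _ := by
    rw [← ModelFrobenioid.baseMap_comp, Iso.inv_hom_id, ModelFrobenioid.baseMap_id]
  -- the conjugate `eA⁻¹ ≫ φo' ≫ eA : A → A`: base-identity, `Div = 0`, Frobenius degree `N`
  have hbc : ModelFrobenioid.baseMap (eA.inv ≫ φo' ≫ eA.hom) = 𝟙 _ := by
    rw [ModelFrobenioid.baseMap_comp, ModelFrobenioid.baseMap_comp, hbo', Category.id_comp, heA₂]
  have hdc : ModelFrobenioid.div (eA.inv ≫ φo' ≫ eA.hom) = 1 := by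
    rw [ModelFrobenioid.div_comp_of_isIso' hΦd eA.inv, ModelFrobenioid.div_comp_of_isIso hΦd φo' eA.hom, hdo',
      map_one]
  have hdegc : ModelFrobenioid.degFr (eA.inv ≫ φo' ≫ eA.hom) = N := by
    rw [ModelFrobenioid.degFr_comp, ModelFrobenioid.degFr_comp, ModelFrobenioid.degFr_eq_one_of_isIso eA.hom,
      ModelFrobenioid.degFr_eq_one_of_isIso eA.inv, one_mul, mul_one, hdego']
  -- hence `eA⁻¹ ≫ φo' ≫ eA = φo ≫ x` for a unit `x ∈ O^×(A)` ([FrdI] Def. 1.3 (ii) for the model)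
  haveI : IsIso (ModelFrobenioid.baseMap φo) := by rw [hbo]; infer_instance
  haveI : IsIso (ModelFrobenioid.baseMap (eA.inv ≫ φo' ≫ eA.hom)) := by rw [hbc]; infer_instance
  obtain ⟨x, hx⟩ := ModelFrobenioid.exists_iso_comp_eq_of_div_eq hBg φo (eA.inv ≫ φo' ≫ eA.hom)
    (hdego.trans hdegc.symm) (hdo.trans hdc.symm)
  have hxb : ModelFrobenioid.baseMap x.hom = 𝟙 _ := by
    have h := congrArg ModelFrobenioid.baseMap hx
    rw [ModelFrobenioid.baseMap_comp, hbo, hbc, Category.id_comp] at h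
    exact h
  have hxu : x ∈ S.units A := ⟨hxb, ModelFrobenioid.degFr_eq_one_of_isIso x.hom⟩
  have hxsu : x.symm ∈ S.units A := by
    have h := (S.units A).inv_mem hxu
    rwa [Aut.Aut_inv_def] at h
  have hxib : ModelFrobenioid.baseMap x.inv = 𝟙 _ := hxsu.1
  -- `Base(α) = Base(α')`, `Base(ᾱ) = Base(ᾱ')`
  have hbα : ModelFrobenioid.baseMap R.α = ModelFrobenioid.baseMap R.αData.α₁ :=
    baseMap_eq_baseMap_α₁ S R.αData
  have hbα' : ModelFrobenioid.baseMap R₂.α = ModelFrobenioid.baseMap R₂.αData.α₁ :=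
    baseMap_eq_baseMap_α₁ S R₂.αData
  -- the lift `ζ₀ : A_N → Ā_N` of `Ā'` through `ᾱ'` at the datum `(α' ≫ eA⁻¹, Ā')` (pull-back property of `ᾱ'`)
  have hbαS : S.base.map R.α = S.base.map R.αData.α₁ := hbα
  have hbα'S : S.base.map R₂.α = S.base.map R₂.αData.α₁ := hbα'
  have key : S.base.map (R.αData.α₁ ≫ eA.inv) = ebs.hom ≫ S.base.map R₂.αData.α₁ := by
    rw [Functor.map_comp, ← hbαS, hebs, Functor.map_comp, Category.assoc, Category.assoc, ← Functor.map_comp,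
      Iso.hom_inv_id, CategoryTheory.Functor.map_id, Category.comp_id, hbα'S]
  have hpb : PreFrobenioid.Base S.F (R.αData.α₁ ≫ eA.inv) = ebs.hom ≫ PreFrobenioid.Base S.F R₂.αData.α₁ := key
  obtain ⟨ζ₀, hζ₀⟩ := (R₂.αData.cond_d R.AN).2 ⟨(R.αData.α₁ ≫ eA.inv, ebs.hom), hpb⟩
  have e1 : ζ₀ ≫ R₂.αData.α₁ = R.αData.α₁ ≫ eA.inv :=
    congrArg (fun p : PreFrobenioid.PullbackHomData S.F R₂.αData.α₁ R.AN => p.1.1) hζ₀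
  have e2 : ModelFrobenioid.baseMap ζ₀ = ebs.hom :=
    congrArg (fun p : PreFrobenioid.PullbackHomData S.F R₂.αData.α₁ R.AN => p.1.2) hζ₀
  -- `ζ₀` is an isomorphism (`deg_Fr = 1`, `Div = 0`, `Base` an isomorphism)
  have hζ₀nd : ModelFrobenioid.degFr ζ₀ = 1 ∧ ModelFrobenioid.div ζ₀ = 1 := by
    have h1 := congrArg ModelFrobenioid.degFr e1
    have h2 := congrArg ModelFrobenioid.div e1
    rw [ModelFrobenioid.degFr_comp ζ₀, hp₁'.1, one_mul, ModelFrobenioid.degFr_comp R.αData.α₁,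
      ModelFrobenioid.degFr_eq_one_of_isIso eA.inv, hp₁.1, mul_one] at h1
    rw [ModelFrobenioid.div_comp_of_isIso hΦd R.αData.α₁ eA.inv, hp₁.2, ModelFrobenioid.div_comp_pull,
      hp₁'.2, map_one, one_mul, hp₁'.1, PNat.one_coe, pow_one] at h2
    exact ⟨h1, h2⟩
  haveI : IsIso (ModelFrobenioid.baseMap ζ₀) := by rw [e2]; infer_instance
  haveI : IsIso ζ₀ := ModelFrobenioid.isIso_of hBg ζ₀ hζ₀nd.2 hζ₀nd.1
  -- the unit `y` of `A_N` over `x⁻¹` along `α'` (pull-back property of `α'`)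
  have hpb₂ : PreFrobenioid.Base S.F (R.αData.α₁ ≫ x.inv) =
      𝟙 _ ≫ PreFrobenioid.Base S.F R.αData.α₁ := by
    change ModelFrobenioid.baseMap (R.αData.α₁ ≫ x.inv) = 𝟙 _ ≫ ModelFrobenioid.baseMap R.αData.α₁
    rw [ModelFrobenioid.baseMap_comp, hxib, Category.comp_id, Category.id_comp]
  obtain ⟨y, hy⟩ := (R.αData.cond_d R.AN).2 ⟨(R.αData.α₁ ≫ x.inv, 𝟙 _), hpb₂⟩
  have e3 : y ≫ R.αData.α₁ = R.αData.α₁ ≫ x.inv :=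
    congrArg (fun p : PreFrobenioid.PullbackHomData S.F R.αData.α₁ R.AN => p.1.1) hy
  have e4 : ModelFrobenioid.baseMap y = 𝟙 _ :=
    congrArg (fun p : PreFrobenioid.PullbackHomData S.F R.αData.α₁ R.AN => p.1.2) hy
  have hynd : ModelFrobenioid.degFr y = 1 ∧ ModelFrobenioid.div y = 1 := by
    have h1 : ModelFrobenioid.degFr (y ≫ R.αData.α₁) = ModelFrobenioid.degFr (R.αData.α₁ ≫ x.inv) := by
      rw [e3]
    have h2 : ModelFrobenioid.div (y ≫ R.αData.α₁) = ModelFrobenioid.div (R.αData.α₁ ≫ x.inv) := by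
      rw [e3]
    obtain ⟨hdx, hvx⟩ := degFr_div_comp_unit S hΦd R.αData.α₁ x.inv
    rw [ModelFrobenioid.degFr_comp, hdx, hp₁.1, one_mul] at h1
    rw [ModelFrobenioid.div_comp_pull, hvx, hp₁.2, map_one, one_mul, hp₁.1, PNat.one_coe, pow_one] at h2
    exact ⟨h1, h2⟩
  haveI : IsIso (ModelFrobenioid.baseMap y) := by rw [e4]; infer_instance
  haveI : IsIso y := ModelFrobenioid.isIso_of hBg y hynd.2 hynd.1
  have hyu : asIso y ∈ S.units R.AN := ⟨e4, hynd.1⟩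
  -- L05 at `R`: `y = tᴺ` for a unit `t` of `A_N`
  have hover : (asIso y).hom ≫ R.αData.α₁ = R.αData.α₁ ≫ x.symm.hom := e3
  obtain ⟨t, htu, htN⟩ := h₅ x.symm (asIso y) hxsu hyu hover
  have htb : ModelFrobenioid.baseMap t.hom = 𝟙 _ := htu.1
  -- Frobenius-normalization of `A_N`: `t ≫ α'' = α'' ≫ tᴺ = α'' ≫ y`
  have hdeg₂ : ModelFrobenioid.degFr R.αData.α₂ = N := by
    have h := congrArg ModelFrobenioid.degFr R.αData.fac
    rw [ModelFrobenioid.degFr_comp, hp₁.1, one_mul, hN] at h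
    exact h
  have hnorm : t.hom ≫ R.αData.α₂ = R.αData.α₂ ≫ y := by
    have h := PreFrobenioid.unit_comp_eq_comp_pow S.F (ModelFrobenioid.isFrobeniusNormalized R.AN)
      R.αData.cond_c.1 htu
    have hd : (PreFrobenioid.degFr S.F R.αData.α₂ : ℕ) = N := congrArg PNat.val hdeg₂
    rw [hd, htN] at h
    exact h
  -- `ζ_A := t ≫ ζ₀`
  refine ⟨t ≪≫ asIso ζ₀, ?_, ?_⟩
  · calc (t ≪≫ asIso ζ₀).hom ≫ R₂.α ≫ eA.hom = t.hom ≫ ζ₀ ≫ (R₂.αData.α₁ ≫ φo') ≫ eA.hom := by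
          rw [Iso.trans_hom, asIso_hom, Category.assoc, hnat']
      _ = t.hom ≫ (ζ₀ ≫ R₂.αData.α₁) ≫ φo' ≫ eA.hom := by simp only [Category.assoc]
      _ = t.hom ≫ R.αData.α₁ ≫ eA.inv ≫ φo' ≫ eA.hom := by rw [e1, Category.assoc]
      _ = t.hom ≫ R.αData.α₁ ≫ φo ≫ x.hom := by rw [← hx]
      _ = t.hom ≫ R.αData.α₂ ≫ R.αData.α₁ ≫ x.hom := by
          rw [reassoc_of% hnat, reassoc_of% R.αData.fac]
      _ = R.αData.α₂ ≫ R.αData.α₁ ≫ x.inv ≫ x.hom := by rw [reassoc_of% hnorm, reassoc_of% e3]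
      _ = R.α := by rw [Iso.inv_hom_id, Category.comp_id, R.αData.fac]
  · ext
    change ModelFrobenioid.baseMap (t.hom ≫ ζ₀) = ebs.hom
    rw [ModelFrobenioid.baseMap_comp, e2, htb, Category.id_comp]

/-! ## §4. Prop. 4.2 (iv) across the isomorphism — the consumer's `hivPiso` shape -/

/-- **[EtTh] Prop. 4.2 (iv) ACROSS AN ISOMORPHISM OF FRACTION-PAIRS, from L05 AT THE FIRST ROOT** (modulo «`Φ`
divisorial» and the canonical reading `hE` of Def. 4.1 (iv)(e)): for an `N`-th root `R` of `P : A → B`, an `N`-th root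
`R₂` of `P₂ : A₂ → B₂`, isomorphisms `eA : A₂ ⥲ A`, `eB : B₂ ⥲ B` with `eA⁻¹ ≫ s'₂ ≫ eB = s'`, `eA⁻¹ ≫ s''₂ ≫ eB = s''`,
and a base isomorphism `Ā' : A_N^bs ⥲ Ā_N^bs` with `Base(α) = Ā' ≫ Base(ᾱ ≫ eA)`: «after possibly replacing `s''_N` by
`v ∘ s''_N`, for some `v ∈ μ_N(B_N)`, there exist isomorphisms `ζ_A : A_N ⥲ Ā_N`, `ζ_B : B_N ⥲ B̄_N` which fit into
commutative diagrams [with `s'_N`, `s''_N`] and satisfy `α = eA ∘ ᾱ ∘ ζ_A`, `β = eB ∘ β̄ ∘ ζ_B`, `ζ_A^bs = Ā'`» — the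
five clauses of abc-iut-w6-d077's binder `hivPiso` for a generic pair.  L06 `zetaA_iso_of_unitRootsUpstairsAt`, L07
`zetaB_upto_unit_iso`, L07′ `rootUnitTorsion_iso`, L08 `betaCompat_iso`. [cite: MochizukiEtTh2009, Prop 4.2 p.89] -/
theorem prop42_iv_iso_of_unitRootsUpstairsAt (hΦd : Objectwise (fun M _ => IsDivisorial M) S.tf.divisorMonoid)
    (hE : ∀ {A B : S.C} (G : Subgroup (Aut A)) (α₂ : A ⟶ A) (α₁ : A ⟶ B),
      S.ArisesFromBaseFrobeniusPair G α₂ α₁ → S.tf.ArisesFromBaseFrobeniusPair G α₂ α₁)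
    {A B : S.C} {f : S.biratUnits A} {P : S.FractionPair f B} {N : ℕ+} (R : S.NthRoot f P N pullFrac)
    (h₅ : ∀ (x : Aut A) (x' : Aut R.AN), x ∈ S.units A → x' ∈ S.units R.AN →
      x'.hom ≫ R.αData.α₁ = R.αData.α₁ ≫ x.hom → ∃ y ∈ S.units R.AN, y ^ (N : ℕ) = x')
    {A₂ B₂ : S.C} {f₂ : S.biratUnits A₂} {P₂ : S.FractionPair f₂ B₂} (R₂ : S.NthRoot f₂ P₂ N pullFrac)
    (eA : A₂ ≅ A) (eB : B₂ ≅ B) (hn : eA.inv ≫ P₂.num ≫ eB.hom = P.num)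
    (hd : eA.inv ≫ P₂.den ≫ eB.hom = P.den) (ebs : S.base.obj R.AN ≅ S.base.obj R₂.AN)
    (hebs : S.base.map R.α = ebs.hom ≫ S.base.map (R₂.α ≫ eA.hom)) :
    ∃ (v : S.mu R.BN N) (ζA : R.AN ≅ R₂.AN) (ζB : R.BN ≅ R₂.BN),
      ζA.hom ≫ R₂.pair.num = R.pair.num ≫ ζB.hom ∧
      ζA.hom ≫ R₂.pair.den = (R.pair.den ≫ (v : Aut R.BN).hom) ≫ ζB.hom ∧
      ζA.hom ≫ R₂.α ≫ eA.hom = R.α ∧ ζB.hom ≫ R₂.β ≫ eB.hom = R.β ∧ S.base.mapIso ζA = ebs := by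
  obtain ⟨ζA, hα, hbs⟩ := zetaA_iso_of_unitRootsUpstairsAt S pullFrac hΦd hE R h₅ R₂ eA ebs hebs
  obtain ⟨u, ζB, hu, hnum, hden⟩ := zetaB_upto_unit_iso S pullFrac hΦd R R₂ eA eB hn hd ζA hα
  exact ⟨⟨u, hu, rootUnitTorsion_iso S pullFrac R R₂ eA eB hn hd ζA ζB u hu hα hnum hden⟩, ζA, ζB, hnum, hden, hα,
    betaCompat_iso S pullFrac R R₂ eA eB hn ζA ζB hα hnum, hbs⟩

/-- **[EtTh] Prop. 4.2 (iv) ACROSS AN ISOMORPHISM OF FRACTION-PAIRS, from the roots-of-constants law over the domain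
`A`** (modulo «`Φ` divisorial» and the canonical reading `hE`): L05 at the root `R` is fed by abc-iut-w4-d044's
`unitRootsUpstairsAt_of_constantRootsAt` («for a Frobenius-trivial `(N, H_⊙^{bs-fld})`-saturated `A″` and `g : A″^bs → A^bs`,
every `Div_B`-trivial `ξ ∈ B(A^bs)` acquires an `N`-th root in `B(A″^bs)` along `g`»; `B` group-like by `isUnit_BΛ`).
[cite: MochizukiEtTh2009, Prop 4.2 p.89] -/
theorem prop42_iv_iso_of_constantRootsAt (hΦd : Objectwise (fun M _ => IsDivisorial M) S.tf.divisorMonoid)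
    (hE : ∀ {A B : S.C} (G : Subgroup (Aut A)) (α₂ : A ⟶ A) (α₁ : A ⟶ B),
      S.ArisesFromBaseFrobeniusPair G α₂ α₁ → S.tf.ArisesFromBaseFrobeniusPair G α₂ α₁)
    {A : S.C}
    (hL : ∀ (A'' : S.C) (N : ℕ+) (g : A''.base ⟶ A.base) (ξ : S.tf.ratFnFunctor.obj (op A.base)),
      S.IsFrobeniusTrivial A'' → S.IsNHSaturatedBsFld S.HodotBsFld A'' N →
      divB S.tf.divisorMonoid S.tf.ratFnFunctor S.tf.divBNatTrans (op A.base) ξ = 1 →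
        ∃ ζ : S.tf.ratFnFunctor.obj (op A''.base), ζ ^ (N : ℕ) = pull S.tf.ratFnFunctor g ξ)
    {B : S.C} {f : S.biratUnits A} {P : S.FractionPair f B} {N : ℕ+} (R : S.NthRoot f P N pullFrac)
    {A₂ B₂ : S.C} {f₂ : S.biratUnits A₂} {P₂ : S.FractionPair f₂ B₂} (R₂ : S.NthRoot f₂ P₂ N pullFrac)
    (eA : A₂ ≅ A) (eB : B₂ ≅ B) (hn : eA.inv ≫ P₂.num ≫ eB.hom = P.num)
    (hd : eA.inv ≫ P₂.den ≫ eB.hom = P.den) (ebs : S.base.obj R.AN ≅ S.base.obj R₂.AN)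
    (hebs : S.base.map R.α = ebs.hom ≫ S.base.map (R₂.α ≫ eA.hom)) :
    ∃ (v : S.mu R.BN N) (ζA : R.AN ≅ R₂.AN) (ζB : R.BN ≅ R₂.BN),
      ζA.hom ≫ R₂.pair.num = R.pair.num ≫ ζB.hom ∧
      ζA.hom ≫ R₂.pair.den = (R.pair.den ≫ (v : Aut R.BN).hom) ≫ ζB.hom ∧
      ζA.hom ≫ R₂.α ≫ eA.hom = R.α ∧ ζB.hom ≫ R₂.β ≫ eB.hom = R.β ∧ S.base.mapIso ζA = ebs :=
  prop42_iv_iso_of_unitRootsUpstairsAt S pullFrac hΦd hE R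
    (unitRootsUpstairsAt_of_constantRootsAt S pullFrac hΦd (S.tf.isGroupLike_ratFnFunctor T.isUnit_BΛ) hL f P N R)
    R₂ eA eB hn hd ebs hebs

/-- **Sanity: at `eA = eB = id` and `A = A_⊙` the iso form IS the typed node** `BiKummerSetting.Prop42_iv` (modulo
«`Φ` divisorial», `hE`, and L05 `UnitRootsUpstairs`) — the port loses nothing. [cite: MochizukiEtTh2009, Prop 4.2 p.89] -/
theorem prop42_iv_of_iso_form (hΦd : Objectwise (fun M _ => IsDivisorial M) S.tf.divisorMonoid)
    (hE : ∀ {A B : S.C} (G : Subgroup (Aut A)) (α₂ : A ⟶ A) (α₁ : A ⟶ B),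
      S.ArisesFromBaseFrobeniusPair G α₂ α₁ → S.tf.ArisesFromBaseFrobeniusPair G α₂ α₁)
    (h₅ : UnitRootsUpstairs S pullFrac) :
    Literature.AnabelianGeometry.EtaleTheta.BiKummerSetting.Prop42_iv S pullFrac := by
  intro B f P N R R' ebs hebs
  have hn : (Iso.refl S.Aodot).inv ≫ P.num ≫ (Iso.refl B).hom = P.num := by simp
  have hd : (Iso.refl S.Aodot).inv ≫ P.den ≫ (Iso.refl B).hom = P.den := by simp
  have hebs' : S.base.map R.α = ebs.hom ≫ S.base.map (R'.α ≫ (Iso.refl S.Aodot).hom) := by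
    rw [Iso.refl_hom, Category.comp_id]; exact hebs
  obtain ⟨v, ζA, ζB, h1, h2, h3, h4, h5⟩ := prop42_iv_iso_of_unitRootsUpstairsAt S pullFrac hΦd hE R
    (fun x x' hx hx' hover => h₅ f P N R x x' hx hx' hover) R' (Iso.refl _) (Iso.refl _) hn hd ebs hebs'
  refine ⟨v, ζA, ζB, h1, h2, ?_, ?_, h5⟩
  · rw [Iso.refl_hom, Category.comp_id] at h3; exact h3
  · rw [Iso.refl_hom, Category.comp_id] at h4; exact h4

end Prop42Sub

end BiKummerSetting

end Literature.AnabelianGeometry.EtaleTheta
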